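import Literature.IUT.HodgeArakelov.BadPrimeGaussianMonoidsGenuineRecordRestrictionIsoPadic

/-!
# [IUTchII] Cor 3.5 (ii) "⥲" at the genuine `θ_env` data of `X̲̲_K` for ANY family of inversion actions (in particular
# print's OUTER inversion `ι_Ÿ`, Rmk 1.4.1 (ii)): the restriction isomorphism over `ℚ̄_pˣ` with (K), (R), `hq₀` derived

S. Mochizuki, *Inter-universal Teichmüller theory II*, kurims Dec-2020 manuscript, Cor 3.5 (ii) p. 95, Prop 3.1 (i)(ii)
pp. 87–88, Prop 2.2 (i)(ii) p. 66, Rmk 1.4.1 (ii) p. 28 ("the unique order two `Δ^tp_{X̲̲_k}`-outer automorphism")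
[cite: Mochizuki2012, Cor 3.5 (ii) p.95]. Claim key DISPUTED (D-0012). PROOF-ONLY companion (abc-iut cell, layer L6,
seat abc-iut-w4-d004 gen 3; node **IUTchII:Cor3.5(ii)**, restriction-ISO clause, sub-DAG row Cor-35.ii.r12). NO
definition, NO `Prop` fact, NO instance.

WHY THIS FILE. The two previous files of this seat (`…GenuineRecordRestrictionIsoProofs`, `…Padic`) are stated for
abc-iut-w4-d019's v1 record `EtaleLevels.thetaEnvRecordKummer … ι₀`, whose "inversions" are the conjugates of the INNER
action of an element `ι₀ ∈ Π^tp_{X̲̲}` — by abc-iut-w4-d019's own READING CORRECTION (v2 note of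
`ThetaEnvDataRecordModel.lean`, Rmk 1.4.1 (ii) p. 28) a DEGENERATE choice: print's `ι_Ÿ` is OUTER. Everything proved there
depends on the record only through abc-iut-w4-d019's bridge `ThetaEnvData.toRecord` — ambient module, `conj`, `Ψ_cns = κ(O)`
(`toRecord_constantMonoid`, `rfl`) — and NOT on the inversion family. HERE the same theorems are stated for the record
`(EtaleLevels.thetaEnvData …).toRecord (h1LimConjMulAut …) (h1LimKummerOn c hA hfi O) iota` with an ARBITRARY family
`iota : Iota → (lim ≃+ lim)` of inversion actions (abc-iut-w4-d030's shape in `MonoThetaProjectiveThetaEnvRecord.lean`), so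
that they apply verbatim to the print-faithful family of `Π^tp_{X̲̲}`-conjugates of one outer pointed inversion (the pair
transport `h1LimAutEquiv` of abc-iut-L6-t1/w4-d010/w5-d072) as soon as a consumer fixes it:
* `hRκ_toRecord` — (R) «`R_t (κ m) = κ₀ m`» at the record, any `iota`, any constants module `A`;
* **`exists_unique_restrictionIso'_toRecord_padic`** — the Cor 3.5 (ii) isomorphism `Ψ^{i₀}_env(𝕄_*) ⥲ Ψ_ξ ⊆ ∏_t κ₀(O)` at
  the record over `A = ℚ̄_pˣ`, ANY `iota`, with (K) (abc-iut-w4-d007's Kummer injectivity theorems), (R), `hU`, `hUsurj`,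
  `hinj`, `hq₀` ALL DERIVED; inputs = sections data + model data + `horb` + **(E) `R_t θ = κ₀ (q_t)`, `q_{t₀}` non-unit**.
* `ThetaEnvData.horb_toRecord_of_orbit` — for ANY produced record (any setting, any `iota`): `horb` follows from `htors`
  (`M^μ_TM ⊆ M^×_TM`, a theorem at the genuine data: abc-iut-w4-d004 p423317 / abc-iut-w5-d192 …OfTower) and the RAW orbit
  clause of Prop 2.2 (ii) read in the limit, `horbit : any two ι-invariants up to torsion of θ(Π) differ by a torsion
  class` — replacing abc-iut-w4-d004's `horb_toRecord` (p420268), whose input is abc-iut-L6-t19's packaged datum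
  `IotaInvariantTheta'` (not instantiable over the genuine setting, which is not a `BadPlaceSetting`), by its one used field.
Nothing here asserts a disputed claim or takes a side on [IUTchIII] Cor 3.12; typed ≠ proved ≠ endorsed.
-/

noncomputable section

namespace Literature.IUT.HodgeArakelov

/-! ### `horb` from the raw orbit clause of Prop 2.2 (ii), for any produced record -/

namespace ThetaEnvData

open TemperedThetaMonoids

universe u

variable {S : ThetaSetting.{u}} {F : ModelFamily S} {Sys : MonoThetaProjSystem F} (T : ThetaEnvData Sys)
  (act : Sys.PiX →* MulAut (Multiplicative T.cohEnv.lim)) {M : Type u} [CommMonoid M]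
  (κ : M →* Multiplicative T.cohEnv.lim) {Iota : Type u} (iota : Iota → (T.D.coh.lim ≃+ T.D.coh.lim))

/-- **`horb` for ANY produced record from the RAW orbit clause.** If any two elements of `θ^{ι}(Π)` (the `ι`-invariants up
to torsion of `θ(Π)` in the limit, for the inversion action `iota i₀`) differ by a class of finite order ([IUTchII]
Prop 2.2 (ii) / Cor 2.8 (i): "`θ^ι(Π_v)` … a `μ_{2l}`-orbit") and torsion classes are units (`htors`, `M^μ_TM ⊆ M^×_TM`),
then `θ^{i₀}_env` of the record `T.toRecord act κ iota` is a single `M^×_TM`-orbit — the junction hypothesis `horb` of the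
Cor 3.5 (ii) restriction isomorphism. [cite: Mochizuki2012, Cor 2.8 (i) p.82] -/
theorem horb_toRecord_of_orbit {i₀ : Iota}
    (horbit : ∀ x ∈ T.thetaIotaLim (iota i₀), ∀ x' ∈ T.thetaIotaLim (iota i₀), IsOfFinAddOrder (x' - x))
    (htors : ∀ u : (T.toRecord act κ iota).H, IsOfFinOrder u → u ∈ (T.toRecord act κ iota).units)
    {θ : (T.toRecord act κ iota).H} (hθ : θ ∈ (T.toRecord act κ iota).thetaEnv i₀) :
    ∀ θ' ∈ (T.toRecord act κ iota).thetaEnv i₀, ∃ u ∈ (T.toRecord act κ iota).units, θ' = u * θ := by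
  intro θ' hθ'
  rw [toRecord_thetaEnv] at hθ hθ'
  have hx : T.transportLim.symm (Multiplicative.toAdd θ) ∈ T.thetaIotaLim (iota i₀) :=
    (T.mem_envSet_iff (T.thetaIotaLim (iota i₀)) θ).mp hθ
  have hx' : T.transportLim.symm (Multiplicative.toAdd θ') ∈ T.thetaIotaLim (iota i₀) :=
    (T.mem_envSet_iff (T.thetaIotaLim (iota i₀)) θ').mp hθ'
  have h1 := horbit _ hx _ hx'
  have h2 : IsOfFinAddOrder ((@Multiplicative.toAdd T.cohEnv.lim θ') - (@Multiplicative.toAdd T.cohEnv.lim θ)) := by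
    have h := (T.transportLim : T.D.coh.lim →+ T.cohEnv.lim).isOfFinAddOrder h1
    simpa [map_sub] using h
  have h3 : IsOfFinOrder (@Multiplicative.ofAdd T.cohEnv.lim
      ((@Multiplicative.toAdd T.cohEnv.lim θ') - (@Multiplicative.toAdd T.cohEnv.lim θ))) :=
    isOfFinOrder_ofAdd_iff.mpr h2
  exact ⟨θ' / θ, htors _ h3, (div_mul_cancel θ' θ).symm⟩

end ThetaEnvData

namespace EtaleLevels

open Literature.AnabelianGeometry.EtaleTheta CohomologySystemOfContH1 EtaleThetaDataOfSetting TemperedThetaMonoids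
  BadPrimeGaussianMonoids

variable {p : ℕ} [Fact p.Prime] {D : Literature.AnabelianGeometry.EtaleTheta.ThetaSetting p}
  {E : D.EtaleThetaData} {l : ℕ} (C : E.DoubleUnderline l) (hC : D.Compat) (hS : D.Sec2Hyps)
  (hl : l.Prime) (hp2 : p ≠ 2) (hpl : p ≠ l) (hζ : ∃ ζ : D.K, IsPrimitiveRoot ζ (4 * l))
  (mods : ∀ M : ℕ+, D.CyclotomeMod l M)
  (f : contCocycles D.toTheta D.DeltaTheta C.GtpYdduu) (hf : f ∈ C.rootCocycles hC)
  (hmods : ∀ (M M' : ℕ+) (h : (M : ℕ) ∣ (M' : ℕ)) (x : D.lDeltaTheta l),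
    MuN.red p M M' h ((mods M').red x) = (mods M).red x)
  (h15 : Literature.AnabelianGeometry.EtaleTheta.ThetaSetting.Prop15iii E hC) (L : C.CuspLabels)
  (hZ : ∀ M : ℕ+, Nonempty (ModelCyclotomes.lDeltaQuot (C.rigidData (mods M) hC hS h15 L) ≃*
    Literature.IUT.HodgeTheaters.ZHat))
  (hcharY : EtaleThetaDataOfSetting.PiYddCharacteristic C)
  (hlim : Function.Bijective (rigidLimHom C hC hS hl hp2 hpl hζ mods f hf hmods h15 L hZ))
  [(EtaleThetaDataOfSetting.PiYdd C).Normal]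
  {Iota : Type}
  (iota : Iota → ((thetaEnvData C hC hS hl hp2 hpl hζ mods f hf hmods h15 L hZ hcharY hlim).D.coh.lim ≃+
    (thetaEnvData C hC hS hl hp2 hpl hζ mods f hf hmods h15 L hZ hcharY hlim).D.coh.lim))
  {Lbl : Type*} {P₀ : TopGroup.{0}} (φ₀ : P₀ →* D.GtpTheta) (s : Lbl → (P₀ →* Pi C))
  (hι : ∀ t, Continuous ((MonoidHom.id (Pi C)).comp (s t)))
  (hN : ∀ t, (⊤ : Subgroup P₀).map ((MonoidHom.id (Pi C)).comp (s t)) ≤ PiYdd C)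
  (hφ : ∀ t, (phi C).comp ((MonoidHom.id (Pi C)).comp (s t)) = φ₀)

section AnyConstants

variable {A : Type} [CommGroup A] [MulDistribMulAction (Pi C) A] [TopologicalSpace A] [RootableBy A ℕ]
  (c : CyclotomeCoefficients (phi C) (D.lDeltaTheta l) A)
  (hA : ∀ b : A, IsOpen (MulAction.stabilizer (Pi C) b : Set (Pi C)))
  (hfi : ∀ b : A, (MulAction.stabilizer (Pi C) b).FiniteIndex)
  (O : Submonoid A)
  [MulDistribMulAction P₀ A]
  (c₀ : CyclotomeCoefficients φ₀ (D.lDeltaTheta l) A)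
  (hA₀ : ∀ b : A, IsOpen (MulAction.stabilizer P₀ b : Set P₀))
  (hfi₀ : ∀ b : A, (MulAction.stabilizer P₀ b).FiniteIndex)

/-- **(R) «restriction of constants» at the record with ANY inversion family** ([IUTchII] Cor 3.5 (i) p. 94): along every
evaluation section `s_t`, `R_t (κ m) = κ₀ m` for every constant `m ∈ O` (`κ₀ := h1LimKummerOn` over `G_v`), in the
hypothesis shape `hRκ` of abc-iut-w4-d004's iso clause. [cite: Mochizuki2012, Cor 3.5 (i) p.94] -/
theorem hRκ_toRecord (hc₀ : ∀ ζ, c₀.hom ζ = c.hom ζ)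
    (hact : ∀ (t : Lbl) (g : P₀) (a : A), g • a = s t g • a)
    (R : Lbl → (((thetaEnvData C hC hS hl hp2 hpl hζ mods f hf hmods h15 L hZ hcharY hlim).toRecord
        (h1LimConjMulAut (phi C) (D.lDeltaTheta l) (PiYdd C))
        (h1LimKummerOn (phi C) (D.lDeltaTheta l) (PiYdd C) c hA hfi O) iota).H →*
      Multiplicative (h1Lim φ₀ (D.lDeltaTheta l) (⊤ : Subgroup P₀) ⊥)))
    (hR : ∀ t y, Multiplicative.toAdd (R t y) =
      h1LimCongr (D.lDeltaTheta l) ⊤ (hφ t) ⊥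
        (h1LimComap (phi C) (D.lDeltaTheta l) ((MonoidHom.id (Pi C)).comp (s t)) (hι t) (hN t)
          (AddEquiv.additiveMultiplicative (h1Lim (phi C) (D.lDeltaTheta l) (PiYdd C) ⊥) (Additive.ofMul y))))
    {i₀ : Iota} (t : Lbl) (m : O)
    (hm : h1LimKummerOn (phi C) (D.lDeltaTheta l) (PiYdd C) c hA hfi O m ∈
      ((thetaEnvData C hC hS hl hp2 hpl hζ mods f hf hmods h15 L hZ hcharY hlim).toRecord
        (h1LimConjMulAut (phi C) (D.lDeltaTheta l) (PiYdd C))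
        (h1LimKummerOn (phi C) (D.lDeltaTheta l) (PiYdd C) c hA hfi O) iota).thetaMonoid i₀) :
    ((R t).comp (((thetaEnvData C hC hS hl hp2 hpl hζ mods f hf hmods h15 L hZ hcharY hlim).toRecord
        (h1LimConjMulAut (phi C) (D.lDeltaTheta l) (PiYdd C))
        (h1LimKummerOn (phi C) (D.lDeltaTheta l) (PiYdd C) c hA hfi O) iota).thetaMonoid i₀).subtype)
        ⟨h1LimKummerOn (phi C) (D.lDeltaTheta l) (PiYdd C) c hA hfi O m, hm⟩ =
      h1LimKummerOn φ₀ (D.lDeltaTheta l) ⊤ c₀ hA₀ hfi₀ O m :=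
  restriction_kummerOn_eq_labelwise'
    ((thetaEnvData C hC hS hl hp2 hpl hζ mods f hf hmods h15 L hZ hcharY hlim).toRecord
        (h1LimConjMulAut (phi C) (D.lDeltaTheta l) (PiYdd C))
        (h1LimKummerOn (phi C) (D.lDeltaTheta l) (PiYdd C) c hA hfi O) iota)
    (phi C) φ₀ (D.lDeltaTheta l) (PiYdd C) c hA hfi c₀ hA₀ hfi₀ O
    (h1LimKummerOn (phi C) (D.lDeltaTheta l) (PiYdd C) c hA hfi O) (MonoidHom.id (Pi C))
    (AddEquiv.additiveMultiplicative (h1Lim (phi C) (D.lDeltaTheta l) (PiYdd C) ⊥)) s hι hN hφ hc₀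
    (fun t g a => hact t g a)
    (additiveMultiplicative_h1LimKummerOn C c hA hfi O) R hR t m hm

end AnyConstants

section Padic

variable [TopologicalSpace (PadicAlgCl p)ˣ]
  (c : CyclotomeCoefficients (phi C) (D.lDeltaTheta l) (PadicAlgCl p)ˣ)
  (hA : ∀ b : (PadicAlgCl p)ˣ, IsOpen (MulAction.stabilizer (Pi C) b : Set (Pi C)))
  (hfi : ∀ b : (PadicAlgCl p)ˣ, (MulAction.stabilizer (Pi C) b).FiniteIndex)
  (O : Submonoid (PadicAlgCl p)ˣ)
  [MulDistribMulAction P₀ (PadicAlgCl p)ˣ]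
  (c₀ : CyclotomeCoefficients φ₀ (D.lDeltaTheta l) (PadicAlgCl p)ˣ)
  (hA₀ : ∀ b : (PadicAlgCl p)ˣ, IsOpen (MulAction.stabilizer P₀ b : Set P₀))
  (hfi₀ : ∀ b : (PadicAlgCl p)ˣ, (MulAction.stabilizer P₀ b).FiniteIndex)

/-- **IUTchII:Cor3.5(ii)** (kurims p.95) "`Ψ^ι_env(M^Θ_*) ⥲ Ψ_ξ(M^Θ_*)`" **at the genuine `θ_env` data over `ℚ̄_pˣ`, for ANY
family `iota` of inversion actions** (in particular the `Π^tp_{X̲̲}`-conjugates of print's OUTER `ι_Ÿ`, Rmk 1.4.1 (ii)): the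
UNIQUE isomorphism `Ψ^{i₀}_env(𝕄_*) ⥲ Ψ_ξ ⊆ ∏_t κ₀(O)` pinned to the restrictions along the evaluation sections, with the
junction hypotheses (K), (R), `hU`, `hUsurj`, `hinj`, `hq₀` ALL DERIVED. Inputs: the sections data (`s_t` continuous into
`Π^tp_{Ÿ̲̲}`, common `φ₀`, `G_v` acting on `ℚ̄_pˣ` as through the sections, one section with finite-index `ε`-image), the
model data (`c`, `c₀` bijective with the same underlying homomorphism; the constant monoid `O ≤ ℚ̄_pˣ`), `horb`
(`θ^{i₀}_env` one `M^×_TM`-orbit — Prop 2.2 (ii) / Prop 1.4 at the label `i₀`), and **(E) `R_t θ = κ₀ (q_t)` with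
`q_{t₀}` a non-unit** — the theta EVALUATION of Cor 2.8 (i) / [EtTh] Prop 1.4 (iii). [cite: Mochizuki2012, Cor 3.5 (ii) p.95] -/
theorem exists_unique_restrictionIso'_toRecord_padic (hc : Function.Bijective c.hom)
    (hc₀ : Function.Bijective c₀.hom) (hc₀c : ∀ ζ, c₀.hom ζ = c.hom ζ)
    (hact : ∀ (t : Lbl) (g : P₀) (a : (PadicAlgCl p)ˣ), g • a = s t g • a) (t₁ : Lbl)
    [((EtaleThetaDataOfSetting.aug C).comp (s t₁)).range.FiniteIndex]
    {i₀ : Iota}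
    {θ : ((thetaEnvData C hC hS hl hp2 hpl hζ mods f hf hmods h15 L hZ hcharY hlim).toRecord
        (h1LimConjMulAut (phi C) (D.lDeltaTheta l) (PiYdd C))
        (h1LimKummerOn (phi C) (D.lDeltaTheta l) (PiYdd C) c hA hfi O) iota).H}
    (hθ : θ ∈ ((thetaEnvData C hC hS hl hp2 hpl hζ mods f hf hmods h15 L hZ hcharY hlim).toRecord
        (h1LimConjMulAut (phi C) (D.lDeltaTheta l) (PiYdd C))
        (h1LimKummerOn (phi C) (D.lDeltaTheta l) (PiYdd C) c hA hfi O) iota).thetaEnv i₀)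
    (horb : ∀ θ' ∈ ((thetaEnvData C hC hS hl hp2 hpl hζ mods f hf hmods h15 L hZ hcharY hlim).toRecord
        (h1LimConjMulAut (phi C) (D.lDeltaTheta l) (PiYdd C))
        (h1LimKummerOn (phi C) (D.lDeltaTheta l) (PiYdd C) c hA hfi O) iota).thetaEnv i₀,
      ∃ u ∈ ((thetaEnvData C hC hS hl hp2 hpl hζ mods f hf hmods h15 L hZ hcharY hlim).toRecord
        (h1LimConjMulAut (phi C) (D.lDeltaTheta l) (PiYdd C))
        (h1LimKummerOn (phi C) (D.lDeltaTheta l) (PiYdd C) c hA hfi O) iota).units, θ' = u * θ)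
    (R : Lbl → (((thetaEnvData C hC hS hl hp2 hpl hζ mods f hf hmods h15 L hZ hcharY hlim).toRecord
        (h1LimConjMulAut (phi C) (D.lDeltaTheta l) (PiYdd C))
        (h1LimKummerOn (phi C) (D.lDeltaTheta l) (PiYdd C) c hA hfi O) iota).H →*
      Multiplicative (h1Lim φ₀ (D.lDeltaTheta l) (⊤ : Subgroup P₀) ⊥)))
    (hR : ∀ t y, Multiplicative.toAdd (R t y) =
      h1LimCongr (D.lDeltaTheta l) ⊤ (hφ t) ⊥
        (h1LimComap (phi C) (D.lDeltaTheta l) ((MonoidHom.id (Pi C)).comp (s t)) (hι t) (hN t)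
          (AddEquiv.additiveMultiplicative (h1Lim (phi C) (D.lDeltaTheta l) (PiYdd C) ⊥) (Additive.ofMul y))))
    (q : Lbl → O)
    (hRθ : ∀ t, R t θ = h1LimKummerOn φ₀ (D.lDeltaTheta l) ⊤ c₀ hA₀ hfi₀ O (q t))
    (t₀ : Lbl) (hq : ¬ IsUnit (q t₀)) :
    ∃! e : ((thetaEnvData C hC hS hl hp2 hpl hζ mods f hf hmods h15 L hZ hcharY hlim).toRecord
          (h1LimConjMulAut (phi C) (D.lDeltaTheta l) (PiYdd C))
          (h1LimKummerOn (phi C) (D.lDeltaTheta l) (PiYdd C) c hA hfi O) iota).thetaMonoid i₀ ≃*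
        gaussianMonoid (fun t =>
          ((R t).comp (((thetaEnvData C hC hS hl hp2 hpl hζ mods f hf hmods h15 L hZ hcharY hlim).toRecord
              (h1LimConjMulAut (phi C) (D.lDeltaTheta l) (PiYdd C))
              (h1LimKummerOn (phi C) (D.lDeltaTheta l) (PiYdd C) c hA hfi O) iota).thetaMonoid i₀).subtype).codRestrict
            (MonoidHom.mrange (h1LimKummerOn φ₀ (D.lDeltaTheta l) ⊤ c₀ hA₀ hfi₀ O))
            (restriction_mem_mrange_gen
              ((thetaEnvData C hC hS hl hp2 hpl hζ mods f hf hmods h15 L hZ hcharY hlim).toRecord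
                (h1LimConjMulAut (phi C) (D.lDeltaTheta l) (PiYdd C))
                (h1LimKummerOn (phi C) (D.lDeltaTheta l) (PiYdd C) c hA hfi O) iota)
              (h1LimKummerOn (phi C) (D.lDeltaTheta l) (PiYdd C) c hA hfi O)
              (h1LimKummerOn φ₀ (D.lDeltaTheta l) ⊤ c₀ hA₀ hfi₀ O)
              (fun t => (R t).comp (((thetaEnvData C hC hS hl hp2 hpl hζ mods f hf hmods h15 L hZ hcharY hlim).toRecord
                (h1LimConjMulAut (phi C) (D.lDeltaTheta l) (PiYdd C))
                (h1LimKummerOn (phi C) (D.lDeltaTheta l) (PiYdd C) c hA hfi O) iota).thetaMonoid i₀).subtype)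
              q (hκ_padic C c hA hfi O hc) (ThetaEnvData.toRecord_constantMonoid _ _ _ _) hθ horb
              (fun t m hm => hRκ_toRecord C hC hS hl hp2 hpl hζ mods f hf hmods h15 L hZ hcharY hlim iota φ₀ s hι hN hφ c
                hA hfi O c₀ hA₀ hfi₀ hc₀c hact R hR t m hm)
              (fun t => hRθ t) t)
            ⟨θ, thetaEnv_subset_thetaMonoid
              ((thetaEnvData C hC hS hl hp2 hpl hζ mods f hf hmods h15 L hZ hcharY hlim).toRecord
                (h1LimConjMulAut (phi C) (D.lDeltaTheta l) (PiYdd C))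
                (h1LimKummerOn (phi C) (D.lDeltaTheta l) (PiYdd C) c hA hfi O) iota) i₀ hθ⟩),
      ∀ x, ((e x : gaussianMonoid _) : Lbl → MonoidHom.mrange (h1LimKummerOn φ₀ (D.lDeltaTheta l) ⊤ c₀ hA₀ hfi₀ O)) =
        MonoidHom.pi (fun t =>
          ((R t).comp (((thetaEnvData C hC hS hl hp2 hpl hζ mods f hf hmods h15 L hZ hcharY hlim).toRecord
              (h1LimConjMulAut (phi C) (D.lDeltaTheta l) (PiYdd C))
              (h1LimKummerOn (phi C) (D.lDeltaTheta l) (PiYdd C) c hA hfi O) iota).thetaMonoid i₀).subtype).codRestrict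
            (MonoidHom.mrange (h1LimKummerOn φ₀ (D.lDeltaTheta l) ⊤ c₀ hA₀ hfi₀ O))
            (restriction_mem_mrange_gen
              ((thetaEnvData C hC hS hl hp2 hpl hζ mods f hf hmods h15 L hZ hcharY hlim).toRecord
                (h1LimConjMulAut (phi C) (D.lDeltaTheta l) (PiYdd C))
                (h1LimKummerOn (phi C) (D.lDeltaTheta l) (PiYdd C) c hA hfi O) iota)
              (h1LimKummerOn (phi C) (D.lDeltaTheta l) (PiYdd C) c hA hfi O)
              (h1LimKummerOn φ₀ (D.lDeltaTheta l) ⊤ c₀ hA₀ hfi₀ O)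
              (fun t => (R t).comp (((thetaEnvData C hC hS hl hp2 hpl hζ mods f hf hmods h15 L hZ hcharY hlim).toRecord
                (h1LimConjMulAut (phi C) (D.lDeltaTheta l) (PiYdd C))
                (h1LimKummerOn (phi C) (D.lDeltaTheta l) (PiYdd C) c hA hfi O) iota).thetaMonoid i₀).subtype)
              q (hκ_padic C c hA hfi O hc) (ThetaEnvData.toRecord_constantMonoid _ _ _ _) hθ horb
              (fun t m hm => hRκ_toRecord C hC hS hl hp2 hpl hζ mods f hf hmods h15 L hZ hcharY hlim iota φ₀ s hι hN hφ c
                hA hfi O c₀ hA₀ hfi₀ hc₀c hact R hR t m hm)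
              (fun t => hRθ t) t)) x := by
  haveI : IsLeftCancelMul O := isLeftCancelMul_submonoid O
  exact exists_unique_restrictionIso'_ofKummer_gen_of_not_isUnit
    ((thetaEnvData C hC hS hl hp2 hpl hζ mods f hf hmods h15 L hZ hcharY hlim).toRecord
      (h1LimConjMulAut (phi C) (D.lDeltaTheta l) (PiYdd C))
      (h1LimKummerOn (phi C) (D.lDeltaTheta l) (PiYdd C) c hA hfi O) iota)
    (h1LimKummerOn (phi C) (D.lDeltaTheta l) (PiYdd C) c hA hfi O)
    (h1LimKummerOn φ₀ (D.lDeltaTheta l) ⊤ c₀ hA₀ hfi₀ O)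
    (fun t => (R t).comp (((thetaEnvData C hC hS hl hp2 hpl hζ mods f hf hmods h15 L hZ hcharY hlim).toRecord
      (h1LimConjMulAut (phi C) (D.lDeltaTheta l) (PiYdd C))
      (h1LimKummerOn (phi C) (D.lDeltaTheta l) (PiYdd C) c hA hfi O) iota).thetaMonoid i₀).subtype)
    q (hκ_padic C c hA hfi O hc) (ThetaEnvData.toRecord_constantMonoid _ _ _ _) hθ horb
    (fun t m hm => hRκ_toRecord C hC hS hl hp2 hpl hζ mods f hf hmods h15 L hZ hcharY hlim iota φ₀ s hι hN hφ c hA hfi O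
      c₀ hA₀ hfi₀ hc₀c hact R hR t m hm)
    (fun t => hRθ t)
    (hκ₀_padic (C := C) (O := O) (φ₀ := φ₀) (s := s) (hι := hι) (c₀ := c₀) (hA₀ := hA₀) (hfi₀ := hfi₀) hc₀ t₁
      (hact t₁))
    t₀ hq

end Padic

end EtaleLevels

end Literature.IUT.HodgeArakelov

end
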